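/-
Copyright (c) 2026 the pub-hodgecm-mathlib formalisation cell (harness21).  Prover seat hodgecm-mathlib-LH4-p08 (g2), req620 Track A «(D-RAM) FOUR-FRAME» squad
(heir LEAD F0P3a-plan (g19) (R-17) «NI2 ⊕ MS»; dealer LH4-plan (g10) WORD #43 (2) «draft the (3c-iii) orbit-set typing HOME»; MS first seat LH4-p11 (g0)).  2026-09-03.
-/
import Summits.HodgeConjecture.HodgeConjecture.Theorems.F0P3cDyRamDiagonalNormalisedSection   -- ★ p855425 TARGET J (this seat); brings ★ p855324 row ideal, ★ `UnitaryLatticeTree{Defs,Dual}`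
import HarnessLib

/-!
# Crux `H413`, line LH4 «(D-RAM) FOUR-FRAME» road — unit U3_Laws (iii), (R-17) MS ROAD A, TIER 2 SUPPORT: «NORMALISED MEMBERS OF A TORUS ORBIT» — for a normalised full
# lattice `M₀ = latt g`, a diagonal translate `diag(z)·M₀` is normalised iff every `z_i` is a UNIT (MEMO §2 (3)(e): `T(E)·M₀ ∩ 𝓛₀ = 𝒯·M₀`)

Cell `hodgecm-mathlib` (D-0151), FLOOR 0, crux item H413 = `stmt-HodgeConjecture-24833`, route of record `HCCMUnconditional`; squad F0∕P3c∕LH4 (req618∕req620).  THEOREMS ONLY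
(no `def`, no instance, no notation, no `sorry`, default heartbeats); lane `--supports stmt-HodgeConjecture-24833 --as helper` (count-neutral).  Sequel of ★ p855425 TARGET J
«NORMALISATION SECTION» toward step (3)(e) of LH4-p10 (g0)'s (S-fin) reduction (MEMO `F0/P3c/LH4/LH4-p10/g0/MEMO-stableLaw-finite.v1.LH4p10g0.md` §2 (3)(e) «`[𝒯 : S̃(M)] =
#([M] ∩ 𝓛₀)`: the orbit `T(E)·M` modulo the free `ϖ^{ℤ³}`-action has `[𝒯 : S̃]` normalised members»): with J (each `ϖ^{ℤ^N}`-orbit has ONE normalised member) the normalised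
members of the full torus orbit `T(E)·M₀ = {diag(z)·M₀ : z ∈ (K^×)^N}` of a normalised `M₀` are exactly its `𝒯 = (𝒪^×)^N`-orbit — the set identity behind (e); the cardinal
`#(𝒯·M₀) = [𝒯 : S̃(M₀)]` is orbit–stabiliser and is left to the assembly (3c-iii) in LH4-p11 (g0)'s index currency (★ p855383 `Λ_S`).

WHAT IS PROVED (generic valued field `K` with `Valued K ℤᵐ⁰`, any `N`; no `σ`, no form, no uniformiser, no completeness).  «Normalised at slot `i`» is spelled def-free as in J:
`(∀ x ∈ M, |x_i| ≤ 1) ∧ ∃ x ∈ M, |x_i| = 1`.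
* §1 `normalisedAt_mapGL_diagonal_unit_iff` — for ANY submodule `M` and a unit diagonal `diag(u)` (`|u_i| = 1`): `diag(u)·M` is normalised at `i` iff `M` is (so `S̃`, dualisability
  bookkeeping etc. may move freely along `𝒯`-orbits); `mem_mapGL_diagonal_iff` — `x ∈ diag(z)·M ↔ (z_i⁻¹ x_i)_i ∈ M` (`z_i ≠ 0`).
* §2 `normalisedAt_latt_iff` — `latt g` (`g ∈ GL_N`) is normalised at `i` iff row `i` of `g` is integral with a unit entry (`(∀ j, |g_{ij}| ≤ 1) ∧ ∃ j, |g_{ij}| = 1`);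
  `normalisedAt_mapGL_diagonal_latt_iff_v_eq_one` — if `latt g` is normalised at `i` then `diag(z)·latt g` is normalised at `i` iff `|z_i| = 1`.
* §3 HEAD **`forall_normalisedAt_mapGL_diagonal_latt_iff`** — for a normalised `M₀ = latt g` and `Z = diag(z) ∈ GL_N(K)`: `Z·M₀` is normalised (at every slot) iff `∀ i, |z_i| = 1`
  («`T(E)·M₀ ∩ 𝓛₀ = 𝒯·M₀`»).
HONEST LABEL.  Count-neutral; nothing printed is asserted; the census laws stay PROVER TARGETS; `HC_CM` is proved only modulo the 7 printed citations (2 remaining named inputs: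
hLiu418 = `stmt-HodgeConjecture-24832`, h413 = `stmt-HodgeConjecture-24833`) until rung 0 closes.

## References
* [Serre1980Trees] J.-P. Serre, *Trees*, Springer (1980), Ch. II §1.1 (lattices `g·𝒪^N`, lattice classes; stabilisers of lattices under diagonal matrices).
* [BruhatTits1972] F. Bruhat, J. Tits, *Groupes réductifs sur un corps local I*, Publ. Math. IHÉS 41 (1972), §10 (the apartment of the diagonal torus; `T(𝒪)` fixes it pointwise).
-/

set_option autoImplicit false

noncomputable section

namespace Summit.HodgeConjecture.HodgeConjecture.Cruxes.H413.F0P3cDyRamDiagonalNormalisedOrbit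

open Matrix
open Literature.NumberTheory.Automorphic Literature.NumberTheory.Automorphic.HermitianLattice
open Literature.NumberTheory.Automorphic.UnitaryLatticeTree
open Summit.HodgeConjecture.HodgeConjecture.Cruxes.H413.F0P3cDyRamLattRowIdeal
open Summit.HodgeConjecture.HodgeConjecture.Cruxes.H413.F0P3cDyRamDiagonalNormalisedSection
open scoped Valued WithZero Matrix MatrixGroups

variable {K : Type*} [Field K] [Valued K ℤᵐ⁰] {N : ℕ}

/-! ## §1 Unit diagonals preserve normalisation (any submodule) -/

/-- **Membership in a diagonal translate**: for `Z = diag(z) ∈ GL_N(K)` (so `z_i ≠ 0`), `x ∈ Z·M ↔ (z_i⁻¹ x_i)_i ∈ M`. [cite: Serre1980Trees, II §1.1] -/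
theorem mem_mapGL_diagonal_iff (Z : GL (Fin N) K) (z : Fin N → K) (hZ : (Z : Matrix (Fin N) (Fin N) K) = Matrix.diagonal z) (hz : ∀ i, z i ≠ 0)
    (M : Submodule 𝒪[K] (Fin N → K)) (x : Fin N → K) :
    x ∈ mapGL Z M ↔ (fun i => (z i)⁻¹ * x i) ∈ M := by
  rw [mapGL, Submodule.mem_map]
  constructor
  · rintro ⟨y, hy, rfl⟩
    convert hy using 1
    funext i
    rw [LinearMap.restrictScalars_apply, Matrix.toLin'_apply, hZ, Matrix.mulVec_diagonal, inv_mul_cancel_left₀ (hz i)]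
  · intro h
    refine ⟨fun i => (z i)⁻¹ * x i, h, ?_⟩
    funext i
    rw [LinearMap.restrictScalars_apply, Matrix.toLin'_apply, hZ, Matrix.mulVec_diagonal, mul_inv_cancel_left₀ (hz i)]

/-- **Unit diagonals preserve normalisation at every slot** (any `𝒪`-submodule `M ⊆ K^N`): for `Z = diag(u)` with `|u_i| = 1` for all `i`, `Z·M` is normalised at slot `i` iff `M`
is — `|(diag(u) y)_i| = |u_i|·|y_i| = |y_i|`.  (So normalisation, and with it the set `𝓛₀`, is `𝒯 = (𝒪^×)^N`-stable.) [cite: Serre1980Trees, II §1.1] [cite: BruhatTits1972, §10] -/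
theorem normalisedAt_mapGL_diagonal_unit_iff (Z : GL (Fin N) K) (u : Fin N → K) (hZ : (Z : Matrix (Fin N) (Fin N) K) = Matrix.diagonal u) (hu : ∀ i, Valued.v (u i) = 1)
    (M : Submodule 𝒪[K] (Fin N → K)) (i : Fin N) :
    ((∀ x ∈ mapGL Z M, Valued.v (x i) ≤ 1) ∧ ∃ x ∈ mapGL Z M, Valued.v (x i) = 1) ↔ ((∀ x ∈ M, Valued.v (x i) ≤ 1) ∧ ∃ x ∈ M, Valued.v (x i) = 1) := by
  have hu0 : ∀ i, u i ≠ 0 := fun i h => by simpa [h] using hu i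
  -- the translate of `y ∈ M` is `diag(u) y`, with `|(diag(u) y)_i| = |y_i|`
  have hmem : ∀ y ∈ M, (fun j => u j * y j) ∈ mapGL Z M := fun y hy => by
    rw [mem_mapGL_diagonal_iff Z u hZ hu0 M]
    convert hy using 1
    funext j
    rw [inv_mul_cancel_left₀ (hu0 j)]
  have hvi : ∀ y : Fin N → K, Valued.v (u i * y i) = Valued.v (y i) := fun y => by rw [map_mul, hu i, one_mul]
  have hvi' : ∀ x : Fin N → K, Valued.v ((u i)⁻¹ * x i) = Valued.v (x i) := fun x => by rw [map_mul, map_inv₀, hu i, inv_one, one_mul]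
  constructor
  · rintro ⟨hle, x, hx, hx1⟩
    refine ⟨fun y hy => (hvi y) ▸ hle _ (hmem y hy), fun j => (u j)⁻¹ * x j, (mem_mapGL_diagonal_iff Z u hZ hu0 M x).1 hx, ?_⟩
    rw [hvi', hx1]
  · rintro ⟨hle, y, hy, hy1⟩
    refine ⟨fun x hx => ?_, fun j => u j * y j, hmem y hy, by rw [hvi, hy1]⟩
    rw [← hvi' x]
    exact hle _ ((mem_mapGL_diagonal_iff Z u hZ hu0 M x).1 hx)

/-! ## §2 Full lattices: normalisation of `latt g` and of its diagonal translates -/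

/-- **`latt g` is normalised at slot `i` iff row `i` of `g` is integral with a unit entry**: `pr_i(latt g) = 𝒪·max_j |g_{ij}|` (★ p855324), so `pr_i = 𝒪` iff `max_j |g_{ij}| = 1`.
[cite: Serre1980Trees, II §1.1] -/
theorem normalisedAt_latt_iff (g : GL (Fin N) K) (i : Fin N) :
    ((∀ x ∈ latt (g : Matrix (Fin N) (Fin N) K), Valued.v (x i) ≤ 1) ∧ ∃ x ∈ latt (g : Matrix (Fin N) (Fin N) K), Valued.v (x i) = 1) ↔
      ((∀ j, Valued.v ((g : Matrix (Fin N) (Fin N) K) i j) ≤ 1) ∧ ∃ j, Valued.v ((g : Matrix (Fin N) (Fin N) K) i j) = 1) := by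
  -- `latt g = 1·latt g` with `1 = diag(1)`; use the J-file bound∕attainment pair at `z = 1`
  have h1 : ((1 : GL (Fin N) K) : Matrix (Fin N) (Fin N) K) = Matrix.diagonal (fun _ => (1 : K)) := by rw [Units.val_one, Matrix.diagonal_one]
  obtain ⟨r, hr⟩ := exists_row_exponent g i
  have hle : ∀ x ∈ latt (g : Matrix (Fin N) (Fin N) K), Valued.v (x i) ≤ WithZero.exp r := fun x hx => by
    have := v_apply_le_of_mem_mapGL_diagonal 1 g _ h1 i hr.1 (by rwa [mapGL_one])
    rwa [map_one, one_mul] at this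
  have hat : ∃ x ∈ latt (g : Matrix (Fin N) (Fin N) K), Valued.v (x i) = WithZero.exp r := by
    obtain ⟨x, hx, hxr⟩ := exists_mem_mapGL_diagonal_v_apply_eq 1 g _ h1 i hr.2
    exact ⟨x, by rwa [mapGL_one] at hx, by rw [hxr, map_one, one_mul]⟩
  constructor
  · rintro ⟨hM, x, hx, hx1⟩
    obtain ⟨x', hx', hx1'⟩ := hat
    have hr0 : r = 0 := by
      have h2 : WithZero.exp r ≤ WithZero.exp (0 : ℤ) := by rw [WithZero.exp_zero, ← hx1']; exact hM x' hx'
      have h3 : WithZero.exp (0 : ℤ) ≤ WithZero.exp r := by rw [WithZero.exp_zero, ← hx1]; exact hle x hx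
      rw [WithZero.exp_le_exp] at h2 h3
      omega
    rw [hr0, WithZero.exp_zero] at hr
    exact hr
  · rintro ⟨hg, j, hj⟩
    have hr0 : WithZero.exp r = 1 := by
      obtain ⟨j', hj'⟩ := hr.2
      exact le_antisymm (hj' ▸ hg j') (hj ▸ hr.1 j)
    rw [hr0] at hle hat
    exact ⟨hle, hat⟩

/-- **A diagonal translate of a slot-normalised full lattice is normalised at that slot iff the scalar is a unit**: if `latt g` is normalised at `i` and `Z = diag(z) ∈ GL_N(K)`, then
`Z·latt g` is normalised at `i` iff `|z_i| = 1` (`pr_i(diag(z)·latt g) = z_i·pr_i(latt g) = z_i·𝒪`). [cite: Serre1980Trees, II §1.1] [cite: BruhatTits1972, §10] -/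
theorem normalisedAt_mapGL_diagonal_latt_iff_v_eq_one (g : GL (Fin N) K) (z : Fin N → K) (Z : GL (Fin N) K) (hZ : (Z : Matrix (Fin N) (Fin N) K) = Matrix.diagonal z) (i : Fin N)
    (hg : (∀ x ∈ latt (g : Matrix (Fin N) (Fin N) K), Valued.v (x i) ≤ 1) ∧ ∃ x ∈ latt (g : Matrix (Fin N) (Fin N) K), Valued.v (x i) = 1) :
    ((∀ x ∈ mapGL Z (latt (g : Matrix (Fin N) (Fin N) K)), Valued.v (x i) ≤ 1) ∧ ∃ x ∈ mapGL Z (latt (g : Matrix (Fin N) (Fin N) K)), Valued.v (x i) = 1) ↔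
      Valued.v (z i) = 1 := by
  rw [normalisedAt_latt_iff] at hg
  have hg' : (∀ j, Valued.v ((g : Matrix (Fin N) (Fin N) K) i j) ≤ WithZero.exp (0 : ℤ)) ∧ ∃ j, Valued.v ((g : Matrix (Fin N) (Fin N) K) i j) = WithZero.exp (0 : ℤ) := by
    rw [WithZero.exp_zero]; exact hg
  have hle : ∀ x ∈ mapGL Z (latt (g : Matrix (Fin N) (Fin N) K)), Valued.v (x i) ≤ Valued.v (z i) := fun x hx => by
    have := v_apply_le_of_mem_mapGL_diagonal Z g z hZ i hg'.1 hx
    rwa [WithZero.exp_zero, mul_one] at this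
  have hat : ∃ x ∈ mapGL Z (latt (g : Matrix (Fin N) (Fin N) K)), Valued.v (x i) = Valued.v (z i) := by
    have := exists_mem_mapGL_diagonal_v_apply_eq Z g z hZ i hg'.2
    rwa [WithZero.exp_zero, mul_one] at this
  constructor
  · rintro ⟨h1, x, hx, hx1⟩
    obtain ⟨x', hx', hx1'⟩ := hat
    exact le_antisymm (hx1' ▸ h1 x' hx') (hx1 ▸ hle x hx)
  · intro hz
    rw [hz] at hle hat
    exact ⟨hle, hat⟩

/-! ## §3 HEAD — the normalised members of a torus orbit -/

/-- **«NORMALISED MEMBERS OF A TORUS ORBIT»** (MEMO §2 (3)(e), set form): let `M₀ = latt g` (`g ∈ GL_N(K)`) be normalised at every slot and `Z = diag(z) ∈ GL_N(K)`.  Then the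
translate `Z·M₀` is normalised (at every slot) iff every `z_i` is a unit.  Hence `T(E)·M₀ ∩ 𝓛₀ = 𝒯·M₀` for the diagonal torus `T(E) = (K^×)^N ⊃ 𝒯 = (𝒪^×)^N`, and with
★ p855425 (ONE normalised member per `ϖ^{ℤ^N}`-orbit) the normalised members of ANY torus orbit `T(E)·M` form a single `𝒯`-orbit — `#([M] ∩ 𝓛₀) = #(𝒯·M₀) = [𝒯 : S̃(M₀)]`
by orbit–stabiliser (the cardinal is left to the (3c-iii) assembly). [cite: Serre1980Trees, II §1.1] [cite: BruhatTits1972, §10] -/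
theorem forall_normalisedAt_mapGL_diagonal_latt_iff {K : Type*} [Field K] [Valued K ℤᵐ⁰] {N : ℕ} (g : GL (Fin N) K) (z : Fin N → K) (Z : GL (Fin N) K)
    (hZ : (Z : Matrix (Fin N) (Fin N) K) = Matrix.diagonal z)
    (hg : ∀ i, (∀ x ∈ latt (g : Matrix (Fin N) (Fin N) K), Valued.v (x i) ≤ 1) ∧ ∃ x ∈ latt (g : Matrix (Fin N) (Fin N) K), Valued.v (x i) = 1) :
    (∀ i, (∀ x ∈ mapGL Z (latt (g : Matrix (Fin N) (Fin N) K)), Valued.v (x i) ≤ 1) ∧ ∃ x ∈ mapGL Z (latt (g : Matrix (Fin N) (Fin N) K)), Valued.v (x i) = 1) ↔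
      ∀ i, Valued.v (z i) = 1 :=
  forall_congr' fun i => normalisedAt_mapGL_diagonal_latt_iff_v_eq_one g z Z hZ i (hg i)

end Summit.HodgeConjecture.HodgeConjecture.Cruxes.H413.F0P3cDyRamDiagonalNormalisedOrbit

end
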